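import Literature.NumberTheory.ConnesConsani2024.SemilocalTransformGeneralS
import HarnessLib

/-!
# Connes–Consani–Moscovici 2024, §4.3 Theorem 4.1 (ii)–(iii) for a general finite `S ∋ ∞`: the semilocal Hermite operator

RH-FREE corpus literature (label, l.1): A. Connes, C. Consani, H. Moscovici, *Zeta zeros and prolate wave
operators*, Ann. Funct. Anal. 15 (2024) = arXiv:2310.18423v2 [bib: `ConnesConsaniMoscovici2024`], §4.3 "Semilocal
Hermite operator", Theorem 4.1: "Let `S` be a finite collection of places (including the archimedean one) …
(2) The eigenfunctions of the semilocal Hermite operator `N_S` are elements of `L²(X_S)^{K_S}` of the form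
`η_S(P_n^S(x)e^{−πx²})`, where `P_n^S` are polynomials obtained by orthonormalization and induction. (3) The matrix
of `ϑ` in the above orthonormal basis of `L²(X_S)^{K_S}` is a Jacobi hermitian matrix" (arXiv chunk p0013:L43–L52),
printed for a GENERAL finite `S`.  NO positivity statement; nothing here bears on the truth of RH.  WHAT THIS IS NOT:
the explicit coefficients of the Jacobi matrix for a general `S` — "deferred to a forthcoming paper" by the source
itself (p. 5, chunk p0005:L23) — nor any claim about Weil positivity.

Cell `rh-crit`, corpus C1, row t13 g5.  The row file `ProlateWaveSemilocal.lean` typed and proved Thm. 4.1 (ii),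
(iii) for `S = {∞, p}` (`ConnesConsaniMoscovici2024_thm_4_1_ii/iii`, `…_holds`); this file is the printed
generality `S = {∞} ∪ P`, `P` any finite set of primes, with `η_S = etaProd P` and its printed expansion
`η_S = Σ_{n P-factored} D_n` (`hasSum_natDilation_etaProd`, `SemilocalTransformGeneralS.lean`).  The architecture of
the single-prime discharge is followed verbatim (Gram–Schmidt in `E_n^S`; reality of the Gram matrix and the
three-term relation from the Gaussian moment recursion, now summed over PAIRS of `P`-factored integers instead of
pairs of powers of `p`; symmetry of `ϑ_S` on the core; zero diagonal by the conjugation trick), citing the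
`η`-independent lemmas of the row file (`gaussMoment_rec`, `gaussComb_succ_scalingGenCoeff`,
`eq_zero_of_gaussComb_eq_zero`, `gaussComb_sub`, `gaussComb_smul`) instead of re-proving them.

What is typed (P = proved, D = definition): `semilocalFiltrationOf P n := η_S(E_n)` (`E_n^S`) D,
`semilocalLayerOf P n` (eigenspaces of `N_S`) D (`_singleton` agreement P); **Thm. 4.1 (ii) general `S`**
`exists_semilocalLayerOf_eq_span` P; the Gram matrix of the dilated Gaussian monomials
`inner_natDilation_gaussMonomialVec` P, `skew_termwise_natDilation` P, `threeTerm_inner_etaProd_gaussMonomialVec` P,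
`im_inner_etaProd_gaussMonomialVec` P, symmetry `inner_etaProd_theta_symm` P, zero diagonal
`inner_etaProd_theta_self` P, **Thm. 4.1 (iii) general `S`** `inner_etaProd_theta_layer_eq_zero` P.  No named fact
(`def … : Prop`); no instance, notation or attribute.

## References

* A. Connes, C. Consani, H. Moscovici, *Zeta zeros and prolate wave operators*, Ann. Funct. Anal. 15 (2024) 87,
  arXiv:2310.18423v2, §4.3 Thm. 4.1; §2.2 eq. (6); §3.4. [ConnesConsaniMoscovici2024]
-/

noncomputable section

open _root_.MeasureTheory Complex Set Filter FourierTransform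
open scoped Real ComplexConjugate ENNReal InnerProductSpace Topology

namespace Literature.NumberTheory.ConnesConsani2024

open Literature.NumberTheory.LFunctions Literature.Analysis.OperatorTheory
open Literature.NumberTheory.ConnesConsani2021 Literature.NumberTheory.Connes2026

/-! ## `E_n^S` and the layers of `N_S` for a general finite `S` -/

section Filtration

/-- **`E_n^S`**, general `S = {∞} ∪ P`, pulled back: "`E_n^S` is the image by `η_S` of the space of products
`P(x)e^{−πx²}` where `P` is an even polynomial of degree `≤ 2n`" (proof of Thm. 4.1 (ii); by definition the span of
`ϑ_S^jξ_S`, `j ≤ n` — "the scaling operator commutes with `η_S`").  For `P = {p}` the row file's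
`semilocalFiltration p n`. [cite: ConnesConsaniMoscovici2024, §4.3 p. 18 (arXiv chunk p0013:L41); proof of Thm. 4.1 (ii) (chunk p0013:L52)] -/
def semilocalFiltrationOf (P : Finset ℕ) (n : ℕ) : Submodule ℂ (Lp ℂ 2 (volume : Measure ℝ)) :=
  (archFiltration n).map (etaProd P).toLinearMap

/-- **The eigenspaces of the semilocal Hermite operator `N_S`**, general `S`: layer `n` is `E_n^S ∩ (E_{n−1}^S)^⊥`
("`N_S` is defined as the grading operator associated with the filtration `(E_n)`").  For `P = {p}` the row file's
`semilocalLayer p n`. [cite: ConnesConsaniMoscovici2024, §4.3 p. 18 (arXiv chunk p0013:L41); §2 p. 6 (chunk p0006:L14)] -/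
def semilocalLayerOf (P : Finset ℕ) (n : ℕ) : Submodule ℂ (Lp ℂ 2 (volume : Measure ℝ)) :=
  semilocalFiltrationOf P n ⊓ (⨆ (k : ℕ) (_ : k < n), semilocalFiltrationOf P k)ᗮ

/-- `P = {p}`: `E_n^{{∞,p}}` agrees with the row file. [cite: ConnesConsaniMoscovici2024, §4.3 p. 18] -/
theorem semilocalFiltrationOf_singleton (q : ℕ) [Fact q.Prime] (n : ℕ) :
    semilocalFiltrationOf {q} n = semilocalFiltration q n := by
  rw [semilocalFiltrationOf, etaProd_singleton]
  rfl

/-- `P = {p}`: the layers agree with the row file. [cite: ConnesConsaniMoscovici2024, §4.3 p. 18] -/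
theorem semilocalLayerOf_singleton (q : ℕ) [Fact q.Prime] (n : ℕ) :
    semilocalLayerOf {q} n = semilocalLayer q n := by
  simp only [semilocalLayerOf, semilocalLayer, semilocalFiltrationOf_singleton]

/-- `η_S(Σ_{k≤n} c_k g_k) = Σ_{k≤n} c_k η_Sg_k`. [cite: ConnesConsaniMoscovici2024, proof of Thm. 4.1 (ii) §4.3 p. 18 (arXiv chunk p0013:L52)] -/
theorem etaProd_gaussComb (P : Finset ℕ) (n : ℕ) (c : ℕ → ℂ) :
    etaProd P (gaussComb n c) = ∑ k ∈ Finset.range (n + 1), c k • etaProd P (gaussMonomialVec k) := by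
  simp only [gaussComb, map_sum, map_smul]

/-- `E_n^S = span{η_S g_k : k ≤ n}`. [cite: ConnesConsaniMoscovici2024, proof of Thm. 4.1 (ii) §4.3 p. 18 (arXiv chunk p0013:L52)] -/
theorem semilocalFiltrationOf_eq_span (P : Finset ℕ) (n : ℕ) :
    semilocalFiltrationOf P n = Submodule.span ℂ ((fun k => etaProd P (gaussMonomialVec k)) '' Set.Iic n) := by
  rw [semilocalFiltrationOf, archFiltration, Submodule.map_span, Set.image_image]
  rfl

/-- `⨆_{k<n} E_k^S = span{η_S g_k : k < n}`. [cite: ConnesConsaniMoscovici2024, §4.3 p. 18 (arXiv chunk p0013:L41)] -/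
theorem iSup_semilocalFiltrationOf_lt (P : Finset ℕ) (n : ℕ) :
    (⨆ (k : ℕ) (_ : k < n), semilocalFiltrationOf P k) =
      Submodule.span ℂ ((fun k => etaProd P (gaussMonomialVec k)) '' Set.Iio n) := by
  apply le_antisymm
  · refine iSup₂_le fun k hk => ?_
    rw [semilocalFiltrationOf_eq_span]
    exact Submodule.span_mono (Set.image_mono fun j (hj : j ≤ k) => lt_of_le_of_lt hj hk)
  · refine Submodule.span_le.2 ?_
    rintro _ ⟨j, hj, rfl⟩
    have hle : semilocalFiltrationOf P j ≤ ⨆ (k : ℕ) (_ : k < n), semilocalFiltrationOf P k :=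
      le_iSup₂ (f := fun k (_ : k < n) => semilocalFiltrationOf P k) j hj
    apply hle
    rw [semilocalFiltrationOf_eq_span]
    exact Submodule.subset_span ⟨j, Set.self_mem_Iic, rfl⟩

/-- `η_SG(n, c) ∈ E_n^S`. [cite: ConnesConsaniMoscovici2024, proof of Thm. 4.1 (ii) §4.3 p. 18 (arXiv chunk p0013:L52)] -/
theorem etaProd_gaussComb_mem (P : Finset ℕ) (n : ℕ) (c : ℕ → ℂ) :
    etaProd P (gaussComb n c) ∈ semilocalFiltrationOf P n := by
  rw [semilocalFiltrationOf_eq_span, etaProd_gaussComb]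
  exact Submodule.sum_mem _ fun k hk =>
    Submodule.smul_mem _ _ (Submodule.subset_span ⟨k, Finset.mem_range_succ_iff.mp hk, rfl⟩)

/-- Every vector of `E_n^S` is `η_S(Σ_{k≤n} d_k g_k)` with `d` supported in `k ≤ n`. [cite: ConnesConsaniMoscovici2024, proof of Thm. 4.1 (ii) §4.3 p. 18 (arXiv chunk p0013:L52)] -/
theorem exists_eq_etaProd_gaussComb {P : Finset ℕ} {n : ℕ} {v : Lp ℂ 2 (volume : Measure ℝ)}
    (hv : v ∈ semilocalFiltrationOf P n) :
    ∃ d : ℕ → ℂ, (∀ k, n < k → d k = 0) ∧ v = etaProd P (gaussComb n d) := by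
  rw [semilocalFiltrationOf_eq_span] at hv
  have hrange : (fun k => etaProd P (gaussMonomialVec k)) '' Set.Iic n =
      Set.range fun i : Fin (n + 1) => etaProd P (gaussMonomialVec i) := by
    ext x
    simp only [Set.mem_image, Set.mem_Iic, Set.mem_range]
    constructor
    · rintro ⟨k, hk, rfl⟩; exact ⟨⟨k, Nat.lt_succ_of_le hk⟩, rfl⟩
    · rintro ⟨i, rfl⟩; exact ⟨i, Nat.le_of_lt_succ i.2, rfl⟩
  rw [hrange] at hv
  obtain ⟨b, hb⟩ := (Submodule.mem_span_range_iff_exists_fun ℂ).1 hv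
  refine ⟨fun k => if h : k < n + 1 then b ⟨k, h⟩ else 0, fun k hk => by
    simp [show ¬ k < n + 1 by omega], ?_⟩
  rw [etaProd_gaussComb, Finset.sum_range (fun k =>
    (if h : k < n + 1 then b ⟨k, h⟩ else 0) • etaProd P (gaussMonomialVec k)), ← hb]
  exact Finset.sum_congr rfl fun i _ => by simp [i.2]

/-- `η_S` is injective on `L²(ℝ)` (bicontinuous, `etaProdEquiv`). [cite: ConnesConsaniMoscovici2024, Prop. 4.3 (i) §4.2 p. 18 (arXiv chunk p0013:L21)] -/
theorem etaProd_injective (P : Finset ℕ) : Function.Injective (etaProd P) := fun a b h =>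
  (etaProdEquiv P).injective (by rwa [etaProdEquiv_apply, etaProdEquiv_apply])

/-- **Theorem 4.1 (ii) for a general finite `S ∋ ∞`** (pulled back): "The eigenfunctions of the semilocal Hermite
operator `N_S` are elements of `L²(X_S)^{K_S}` of the form `η_S(P_n^S(x)e^{−πx²})`, where `P_n^S` are polynomials
obtained by orthonormalization and induction" — every layer `E_n^S ⊖ E_{n−1}^S` is the line spanned by
`η_S(Σ_{k≤n} c_k x^{2k}e^{−πx²})` for some coefficients with `c_n ≠ 0` (Gram–Schmidt: `v = η_Sg_n −
P_{E_{n−1}^S}(η_Sg_n)`; "since `η_S` is not unitary the orthogonalisation process delivers polynomials `P_n^S` which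
depend upon `S`").  PROVED.  RH-FREE. [cite: ConnesConsaniMoscovici2024, Thm. 4.1 (ii) §4.3 p. 18 (arXiv chunk p0013:L47, proof L52)] -/
theorem exists_semilocalLayerOf_eq_span (P : Finset ℕ) (n : ℕ) :
    ∃ c : ℕ → ℂ, c n ≠ 0 ∧ semilocalLayerOf P n = ℂ ∙ etaProd P (gaussComb n c) := by
  set v : ℕ → Lp ℂ 2 (volume : Measure ℝ) := fun k => etaProd P (gaussMonomialVec k) with hv
  set W : Submodule ℂ (Lp ℂ 2 (volume : Measure ℝ)) := Submodule.span ℂ (v '' Set.Iio n) with hWdef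
  set E : Submodule ℂ (Lp ℂ 2 (volume : Measure ℝ)) := Submodule.span ℂ (v '' Set.Iic n) with hEdef
  have hE : semilocalFiltrationOf P n = E := semilocalFiltrationOf_eq_span P n
  have hW : (⨆ (k : ℕ) (_ : k < n), semilocalFiltrationOf P k) = W := iSup_semilocalFiltrationOf_lt P n
  have hWE : W ≤ E := Submodule.span_mono (Set.image_mono Set.Iio_subset_Iic_self)
  haveI : FiniteDimensional ℂ W :=
    FiniteDimensional.span_of_finite ℂ ((Set.finite_Iio n).image v)
  haveI : W.HasOrthogonalProjection := Submodule.HasOrthogonalProjection.ofCompleteSpace W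
  obtain ⟨y, hy, z, hz, hyz⟩ := Submodule.exists_add_mem_mem_orthogonal (K := W) (v n)
  have hWrange : W = Submodule.span ℂ (Set.range fun i : Fin n => v i) := by
    rw [hWdef]
    congr 1
    ext x
    simp only [Set.mem_image, Set.mem_Iio, Set.mem_range]
    constructor
    · rintro ⟨k, hk, rfl⟩; exact ⟨⟨k, hk⟩, rfl⟩
    · rintro ⟨i, rfl⟩; exact ⟨i, i.2, rfl⟩
  have hy' : y ∈ Submodule.span ℂ (Set.range fun i : Fin n => v i) := hWrange ▸ hy
  obtain ⟨b, hb⟩ := (Submodule.mem_span_range_iff_exists_fun ℂ).1 hy'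
  let c : ℕ → ℂ := fun k => if h : k < n then -(b ⟨k, h⟩) else if k = n then 1 else 0
  have hcn : c n = 1 := by simp [c]
  have hcomb : etaProd P (gaussComb n c) = z := by
    have hsum : gaussComb n c = gaussMonomialVec n - ∑ i : Fin n, b i • gaussMonomialVec i := by
      rw [gaussComb, Finset.sum_range_succ, hcn, one_smul, Finset.sum_range fun k => c k • gaussMonomialVec k]
      have : ∑ i : Fin n, c i • gaussMonomialVec i = -(∑ i : Fin n, b i • gaussMonomialVec i) := by
        rw [← Finset.sum_neg_distrib]
        refine Finset.sum_congr rfl fun i _ => ?_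
        simp [c, i.2, neg_smul]
      rw [this]; abel
    rw [hsum, map_sub, map_sum]
    simp only [map_smul]
    have hvn : etaProd P (gaussMonomialVec n) = v n := rfl
    rw [hvn, hyz, hb]
    abel
  refine ⟨c, by rw [hcn]; exact one_ne_zero, ?_⟩
  rw [semilocalLayerOf, hE, hW, hcomb]
  apply le_antisymm
  · intro x hx
    obtain ⟨hxE, hxW⟩ := Submodule.mem_inf.1 hx
    have hxE' : x ∈ Submodule.span ℂ (insert (v n) (v '' Set.Iio n)) := by
      rw [← Set.image_insert_eq, Set.Iio_insert]; exact hxE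
    obtain ⟨a, w, hw, hxaw⟩ := Submodule.mem_span_insert.1 hxE'
    have hdiff : x - a • z ∈ W ⊓ Wᗮ := by
      refine Submodule.mem_inf.2 ⟨?_, Submodule.sub_mem _ hxW (Submodule.smul_mem _ a hz)⟩
      have : x - a • z = a • y + w := by
        rw [hxaw, hyz, smul_add]; abel
      rw [this]
      exact Submodule.add_mem _ (Submodule.smul_mem _ a hy) hw
    rw [Submodule.inf_orthogonal_eq_bot, Submodule.mem_bot, sub_eq_zero] at hdiff
    rw [hdiff]
    exact Submodule.smul_mem _ a (Submodule.mem_span_singleton_self z)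
  · rw [Submodule.span_singleton_le_iff_mem]
    refine Submodule.mem_inf.2 ⟨?_, hz⟩
    have hz' : z = v n - y := by rw [hyz]; abel
    rw [hz']
    exact Submodule.sub_mem _ (Submodule.subset_span ⟨n, Set.self_mem_Iic, rfl⟩) (hWE hy)

end Filtration

/-! ## The Gram matrix of the dilated Gaussian monomials over pairs of `P`-factored integers -/

section Gram

/-- `D_a g_j = g_j(a ·)` a.e. for a positive integer `a` (`g_j = x^{2j}e^{−πx²}`) — the terms of `η_S(P(x)e^{−πx²})`
(eq. (44)). [cite: ConnesConsaniMoscovici2024, §4.2 eq. (44) p. 16 (arXiv chunk p0012:L74); proof of Thm. 4.1 (ii) §4.3 p. 18 (arXiv chunk p0013:L52)] -/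
theorem natDilation_gaussMonomialVec_coeFn {a : ℕ} (ha : a ≠ 0) (j : ℕ) :
    ((natDilation a (gaussMonomialVec j) : Lp ℂ 2 (volume : Measure ℝ)) : ℝ → ℂ)
      =ᵐ[volume] fun x => gaussMonomialFun j ((a : ℝ) * x) := by
  rw [natDilation_of_ne_zero ha]
  refine (lpDilation_coeFn (V := ℝ) (F := ℂ) (p := (2 : ℝ≥0∞)) _ _ _).trans ?_
  have h := ae_eq_comp_smul (V := ℝ) (MemLp.coeFn_toLp (memLp_gaussMonomialFun j))
    (a := (a : ℝ)) (Nat.cast_ne_zero.mpr ha)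
  simpa only [gaussMonomialVec, smul_eq_mul] using h

/-- **The Gram matrix of the dilated Gaussian monomials, entrywise**, general dilations:
`⟪D_a g_j, D_b g_k⟫ = a^{2j}b^{2k} ∫ x^{2(j+k)} e^{−π(a²+b²)x²} dx` (a real Gaussian moment).
[cite: ConnesConsaniMoscovici2024, proof of Thm. 4.1 (ii) §4.3 p. 18 (arXiv chunk p0013:L52)] -/
theorem inner_natDilation_gaussMonomialVec {a b : ℕ} (ha : a ≠ 0) (hb : b ≠ 0) (j k : ℕ) :
    ⟪natDilation a (gaussMonomialVec j), natDilation b (gaussMonomialVec k)⟫_ℂ =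
      (((a : ℝ) ^ (2 * j) * (b : ℝ) ^ (2 * k) *
        ∫ x : ℝ, x ^ (2 * (j + k)) * Real.exp (-(π * ((a : ℝ) ^ 2 + (b : ℝ) ^ 2)) * x ^ 2) : ℝ) : ℂ) := by
  rw [MeasureTheory.L2.inner_def]
  have hae : (fun x : ℝ =>
      ⟪((natDilation a (gaussMonomialVec j) : Lp ℂ 2 (volume : Measure ℝ)) : ℝ → ℂ) x,
        ((natDilation b (gaussMonomialVec k) : Lp ℂ 2 (volume : Measure ℝ)) : ℝ → ℂ) x⟫_ℂ)
      =ᵐ[volume] fun x => (((a : ℝ) ^ (2 * j) * (b : ℝ) ^ (2 * k) * (x ^ (2 * (j + k)) *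
          Real.exp (-(π * ((a : ℝ) ^ 2 + (b : ℝ) ^ 2)) * x ^ 2)) : ℝ) : ℂ) := by
    filter_upwards [natDilation_gaussMonomialVec_coeFn ha j, natDilation_gaussMonomialVec_coeFn hb k]
      with x h1 h2
    rw [h1, h2, gaussMonomialFun, gaussMonomialFun, RCLike.inner_apply', conj_ofReal, ← ofReal_mul]
    congr 1
    have hexp : Real.exp (-(π * ((a : ℝ) * x) ^ 2)) * Real.exp (-(π * ((b : ℝ) * x) ^ 2)) =
        Real.exp (-(π * ((a : ℝ) ^ 2 + (b : ℝ) ^ 2)) * x ^ 2) := by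
      rw [← Real.exp_add]
      congr 1
      ring
    calc ((a : ℝ) * x) ^ (2 * j) * Real.exp (-(π * ((a : ℝ) * x) ^ 2)) *
          (((b : ℝ) * x) ^ (2 * k) * Real.exp (-(π * ((b : ℝ) * x) ^ 2)))
        = ((a : ℝ) * x) ^ (2 * j) * ((b : ℝ) * x) ^ (2 * k) *
            (Real.exp (-(π * ((a : ℝ) * x) ^ 2)) * Real.exp (-(π * ((b : ℝ) * x) ^ 2))) := by ring
      _ = _ := by rw [hexp]; ring
  rw [integral_congr_ae hae, integral_complex_ofReal, integral_const_mul]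

/-- **`ϑ` is symmetric between dilated Gaussian monomials** (termwise in `η_S = Σ_n D_n`):
`((2j+½)+(2k+½))⟪D_ag_j, D_bg_k⟫ = 2π(⟪D_ag_{j+1}, D_bg_k⟫ + ⟪D_ag_j, D_bg_{k+1}⟫)` — the moment recursion at
`B = π(a²+b²)` (`gaussMoment_rec` of the row file). [cite: ConnesConsaniMoscovici2024, proof of Thm. 4.1 (ii) §4.3 p. 18 (arXiv chunk p0013:L52); §3.4 p. 12 (arXiv chunk p0009:L44–L48)] -/
theorem skew_termwise_natDilation {a b : ℕ} (ha : a ≠ 0) (hb : b ≠ 0) (j k : ℕ) :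
    ((2 * j + 1 / 2 : ℂ) + (2 * k + 1 / 2)) *
        ⟪natDilation a (gaussMonomialVec j), natDilation b (gaussMonomialVec k)⟫_ℂ =
      2 * π * (⟪natDilation a (gaussMonomialVec (j + 1)), natDilation b (gaussMonomialVec k)⟫_ℂ +
        ⟪natDilation a (gaussMonomialVec j), natDilation b (gaussMonomialVec (k + 1))⟫_ℂ) := by
  simp only [inner_natDilation_gaussMonomialVec ha hb]
  have e1 : 2 * (j + 1 + k) = 2 * ((j + k) + 1) := by ring
  have e2 : 2 * (j + (k + 1)) = 2 * ((j + k) + 1) := by ring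
  rw [e1, e2]
  have ha0 : (0 : ℝ) < a := by exact_mod_cast Nat.pos_of_ne_zero ha
  have hb0 : (0 : ℝ) < b := by exact_mod_cast Nat.pos_of_ne_zero hb
  have hBpos : 0 < π * ((a : ℝ) ^ 2 + (b : ℝ) ^ 2) :=
    mul_pos Real.pi_pos (add_pos (pow_pos ha0 _) (pow_pos hb0 _))
  have hrec := gaussMoment_rec (j + k) hBpos
  have hrecC := congrArg (fun r : ℝ => (r : ℂ)) hrec
  push_cast at hrecC ⊢
  linear_combination ((a : ℂ) ^ (2 * j) * (b : ℂ) ^ (2 * k)) * hrecC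

variable {P : Finset ℕ}

/-- `⟪u, η_S v⟫ = Σ_{n P-factored} ⟪u, D_n v⟫` (eq. (44) summed inside the scalar product). [cite: ConnesConsaniMoscovici2024, §4.2 eq. (44) p. 16 (arXiv chunk p0012:L74)] -/
theorem hasSum_inner_natDilation_right (hP : ∀ p ∈ P, p.Prime) (u v : Lp ℂ 2 (volume : Measure ℝ)) :
    HasSum (fun n : Nat.factoredNumbers P => ⟪u, natDilation n v⟫_ℂ) ⟪u, etaProd P v⟫_ℂ := by
  have h := (hasSum_natDilation_apply_etaProd hP v).mapL (innerSL ℂ u)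
  simpa only [innerSL_apply_apply] using h

/-- `⟪η_S u, v⟫ = Σ_{n P-factored} ⟪D_n u, v⟫`. [cite: ConnesConsaniMoscovici2024, §4.2 eq. (44) p. 16 (arXiv chunk p0012:L74)] -/
theorem hasSum_inner_natDilation_left (hP : ∀ p ∈ P, p.Prime) (u v : Lp ℂ 2 (volume : Measure ℝ)) :
    HasSum (fun n : Nat.factoredNumbers P => ⟪natDilation n u, v⟫_ℂ) ⟪etaProd P u, v⟫_ℂ := by
  have h := (hasSum_inner_natDilation_right hP v u).star
  simpa only [Complex.star_def, inner_conj_symm] using h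

/-- **The three-term (Jacobi) relation of the Gram matrix** `r_{jk} = ⟪η_Sg_j, η_Sg_k⟫`, general `S`:
`(2j+2k+1)·r_{jk} = 2π(r_{j+1,k} + r_{j,k+1})` — symmetry of `ϑ_S` on the `η_S`-image of the Gaussian polynomials,
summed termwise over pairs of `P`-factored integers. [cite: ConnesConsaniMoscovici2024, Thm. 4.1 (iii) §4.3 p. 18 (arXiv chunk p0013:L49, proof L52); §2.2 eq. (6) p. 6] -/
theorem threeTerm_inner_etaProd_gaussMonomialVec (hP : ∀ p ∈ P, p.Prime) (j k : ℕ) :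
    ((2 * j + 1 / 2 : ℂ) + (2 * k + 1 / 2)) *
        ⟪etaProd P (gaussMonomialVec j), etaProd P (gaussMonomialVec k)⟫_ℂ =
      2 * π * (⟪etaProd P (gaussMonomialVec (j + 1)), etaProd P (gaussMonomialVec k)⟫_ℂ +
        ⟪etaProd P (gaussMonomialVec j), etaProd P (gaussMonomialVec (k + 1))⟫_ℂ) := by
  have hn0 : ∀ n : Nat.factoredNumbers P, (n : ℕ) ≠ 0 := fun n => Nat.ne_zero_of_mem_factoredNumbers n.2
  have lvl1 : ∀ i : Nat.factoredNumbers P, ((2 * j + 1 / 2 : ℂ) + (2 * k + 1 / 2)) *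
        ⟪natDilation i (gaussMonomialVec j), etaProd P (gaussMonomialVec k)⟫_ℂ =
      2 * π * (⟪natDilation i (gaussMonomialVec (j + 1)), etaProd P (gaussMonomialVec k)⟫_ℂ +
        ⟪natDilation i (gaussMonomialVec j), etaProd P (gaussMonomialVec (k + 1))⟫_ℂ) := by
    intro i
    have hL := (hasSum_inner_natDilation_right hP (natDilation i (gaussMonomialVec j))
      (gaussMonomialVec k)).mul_left (((2 * j + 1 / 2 : ℂ) + (2 * k + 1 / 2)))
    have hR := ((hasSum_inner_natDilation_right hP (natDilation i (gaussMonomialVec (j + 1)))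
        (gaussMonomialVec k)).add
      (hasSum_inner_natDilation_right hP (natDilation i (gaussMonomialVec j))
        (gaussMonomialVec (k + 1)))).mul_left (2 * π : ℂ)
    refine hL.unique ?_
    convert hR using 1
    funext l
    exact skew_termwise_natDilation (hn0 i) (hn0 l) j k
  have hL := (hasSum_inner_natDilation_left hP (gaussMonomialVec j)
    (etaProd P (gaussMonomialVec k))).mul_left (((2 * j + 1 / 2 : ℂ) + (2 * k + 1 / 2)))
  have hR := ((hasSum_inner_natDilation_left hP (gaussMonomialVec (j + 1))
      (etaProd P (gaussMonomialVec k))).add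
    (hasSum_inner_natDilation_left hP (gaussMonomialVec j)
      (etaProd P (gaussMonomialVec (k + 1))))).mul_left (2 * π : ℂ)
  refine hL.unique ?_
  convert hR using 1
  funext i
  exact lvl1 i

/-- A series of reals has a real sum. [folklore] -/
private theorem im_eq_zero_of_hasSum' {ι : Type*} {f : ι → ℂ} {a : ℂ} (h : HasSum f a)
    (hf : ∀ n, (f n).im = 0) : a.im = 0 := by
  have h2 := ((Complex.hasSum_iff f a).mp h).2
  simp only [hf] at h2
  exact h2.unique hasSum_zero

/-- **The Gram matrix `⟪η_Sg_j, η_Sg_k⟫` is real**, general `S` (every `D_ng_j` is real-valued) — the reality behind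
"Jacobi hermitian matrix" in Thm. 4.1 (iii). [cite: ConnesConsaniMoscovici2024, Thm. 4.1 (iii) §4.3 p. 18 (arXiv chunk p0013:L49, proof L52)] -/
theorem im_inner_etaProd_gaussMonomialVec (hP : ∀ p ∈ P, p.Prime) (j k : ℕ) :
    (⟪etaProd P (gaussMonomialVec j), etaProd P (gaussMonomialVec k)⟫_ℂ).im = 0 := by
  have hn0 : ∀ n : Nat.factoredNumbers P, (n : ℕ) ≠ 0 := fun n => Nat.ne_zero_of_mem_factoredNumbers n.2
  refine im_eq_zero_of_hasSum' (hasSum_inner_natDilation_left hP (gaussMonomialVec j)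
    (etaProd P (gaussMonomialVec k))) fun i => ?_
  refine im_eq_zero_of_hasSum' (hasSum_inner_natDilation_right hP
    (natDilation i (gaussMonomialVec j)) (gaussMonomialVec k)) fun l => ?_
  rw [inner_natDilation_gaussMonomialVec (hn0 i) (hn0 l)]
  exact Complex.ofReal_im _

/-- `conj ⟪η_Sg_j, η_Sg_k⟫ = ⟪η_Sg_j, η_Sg_k⟫`. [cite: ConnesConsaniMoscovici2024, Thm. 4.1 (iii) §4.3 p. 18 (arXiv chunk p0013:L49, proof L52)] -/
theorem conj_inner_etaProd_gaussMonomialVec (hP : ∀ p ∈ P, p.Prime) (j k : ℕ) :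
    conj ⟪etaProd P (gaussMonomialVec j), etaProd P (gaussMonomialVec k)⟫_ℂ =
      ⟪etaProd P (gaussMonomialVec j), etaProd P (gaussMonomialVec k)⟫_ℂ :=
  Complex.conj_eq_iff_im.mpr (im_inner_etaProd_gaussMonomialVec hP j k)

/-- Sesquilinear expansion of `⟪η_SG(M, a), η_SG(N, b)⟫` against the Gram matrix. [cite: ConnesConsaniMoscovici2024, proof of Thm. 4.1 (ii) §4.3 p. 18 (arXiv chunk p0013:L52)] -/
theorem inner_etaProd_gaussComb (P : Finset ℕ) (M N : ℕ) (a b : ℕ → ℂ) :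
    ⟪etaProd P (gaussComb M a), etaProd P (gaussComb N b)⟫_ℂ =
      ∑ j ∈ Finset.range (M + 1), ∑ k ∈ Finset.range (N + 1),
        conj (a j) * b k * ⟪etaProd P (gaussMonomialVec j), etaProd P (gaussMonomialVec k)⟫_ℂ := by
  simp only [etaProd_gaussComb, sum_inner, inner_sum, inner_smul_left, inner_smul_right, Finset.mul_sum]
  rw [Finset.sum_comm]
  exact Finset.sum_congr rfl fun j _ => Finset.sum_congr rfl fun k _ => by ring

/-- **`ϑ_S` is symmetric on the monomials of `E_n^S`**, general `S`: `⟪η_S(ϑg_j), η_Sg_k⟫ = ⟪η_Sg_j, η_S(ϑg_k)⟫`.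
[cite: ConnesConsaniMoscovici2024, Thm. 4.1 (iii) §4.3 p. 18 (arXiv chunk p0013:L49, proof L52); §3.2 p. 10 (arXiv chunk p0008:L63)] -/
theorem inner_etaProd_theta_symm_mono (hP : ∀ p ∈ P, p.Prime) (j k : ℕ) :
    ⟪etaProd P ((-(I * (2 * j + 1 / 2))) • gaussMonomialVec j +
        ((2 * π : ℂ) * I) • gaussMonomialVec (j + 1)), etaProd P (gaussMonomialVec k)⟫_ℂ =
      ⟪etaProd P (gaussMonomialVec j), etaProd P ((-(I * (2 * k + 1 / 2))) •
        gaussMonomialVec k + ((2 * π : ℂ) * I) • gaussMonomialVec (k + 1))⟫_ℂ := by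
  have h3 := threeTerm_inner_etaProd_gaussMonomialVec hP j k
  simp only [map_add, map_smul, inner_add_left, inner_add_right, inner_smul_left, inner_smul_right]
  simp only [map_neg, map_mul, map_add, map_div₀, map_one, Complex.conj_I, map_ofNat, map_natCast,
    Complex.conj_ofReal]
  linear_combination I * h3

/-- **Symmetry of `ϑ_S` on the `η_S`-image of the Gaussian polynomials**, general `S`:
`⟪ϑ_S η_SG(M,c), η_SG(N,d)⟫ = ⟪η_SG(M,c), ϑ_S η_SG(N,d)⟫` for `c_{M+1} = d_{N+1} = 0`. [cite: ConnesConsaniMoscovici2024, Thm. 4.1 (iii) §4.3 p. 18 (arXiv chunk p0013:L49, proof L52); §3.2 p. 10 (arXiv chunk p0008:L63)] -/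
theorem inner_etaProd_theta_symm (hP : ∀ p ∈ P, p.Prime) (M N : ℕ) (c d : ℕ → ℂ) (hc : c (M + 1) = 0)
    (hd : d (N + 1) = 0) :
    ⟪etaProd P (gaussComb (M + 1) (scalingGenCoeff c)), etaProd P (gaussComb N d)⟫_ℂ =
      ⟪etaProd P (gaussComb M c), etaProd P (gaussComb (N + 1) (scalingGenCoeff d))⟫_ℂ := by
  rw [gaussComb_succ_scalingGenCoeff M c hc, gaussComb_succ_scalingGenCoeff N d hd, gaussComb, gaussComb]
  simp only [map_sum, map_smul, sum_inner, inner_sum, inner_smul_left, inner_smul_right]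
  refine Finset.sum_congr rfl fun j _ => ?_
  congr 1
  refine Finset.sum_congr rfl fun k _ => ?_
  rw [inner_etaProd_theta_symm_mono hP]

/-- If `η_SG(m, c) = 0` (`c` supported in `k ≤ m`) then the `ϑ_S`-image `η_SG(m+1, ϑc)` vanishes too. [cite: ConnesConsaniMoscovici2024, Thm. 4.1 (iii) §4.3 p. 18 (arXiv chunk p0013:L49, proof L52)] -/
theorem etaProd_theta_eq_zero (P : Finset ℕ) {m : ℕ} {c : ℕ → ℂ} (hc : ∀ k, m < k → c k = 0)
    (h0 : etaProd P (gaussComb m c) = 0) :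
    etaProd P (gaussComb (m + 1) (scalingGenCoeff c)) = 0 := by
  have hG : gaussComb m c = 0 := etaProd_injective P (by rw [h0, map_zero])
  have hc0 : ∀ k, c k = 0 := fun k =>
    if hk : k ≤ m then eq_zero_of_gaussComb_eq_zero hG k hk else hc k (not_le.mp hk)
  have hθ : scalingGenCoeff c = fun _ => 0 := by
    funext k; simp [scalingGenCoeff, hc0]
  rw [hθ]
  simp [gaussComb]

/-- **Zero diagonal of the Jacobi matrix**, general `S`: `⟪ϑ_S u, u⟫ = 0` for a layer vector
`u = η_SG(m, c) ∈ E_m^S ⊖ E_{m−1}^S` (printed: eq. (6) for the even pair `(ϑ_S, ξ_S)`; here, as in the row file, by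
the conjugation trick: the Gram matrix is real, so `η_SG(m, c̄)` lies in the same layer LINE, `c̄ = λc` with `|λ| = 1`,
and `z = ⟪ϑ_S u, u⟫` satisfies `z = conj z = −z`). [cite: ConnesConsaniMoscovici2024, Thm. 4.1 (iii) §4.3 p. 18 (arXiv chunk p0013:L49, proof L52); §2.2 eq. (6) p. 6] -/
theorem inner_etaProd_theta_self (hP : ∀ p ∈ P, p.Prime) {m : ℕ} {c : ℕ → ℂ} (hc : ∀ k, m < k → c k = 0)
    (hu : etaProd P (gaussComb m c) ∈ semilocalLayerOf P m) :
    ⟪etaProd P (gaussComb (m + 1) (scalingGenCoeff c)), etaProd P (gaussComb m c)⟫_ℂ = 0 := by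
  by_cases hu0 : etaProd P (gaussComb m c) = 0
  · rw [etaProd_theta_eq_zero P hc hu0, inner_zero_left]
  have hr : ∀ j k : ℕ, ⟪etaProd P (gaussMonomialVec j), etaProd P (gaussMonomialVec k)⟫_ℂ =
      ⟪etaProd P (gaussMonomialVec k), etaProd P (gaussMonomialVec j)⟫_ℂ := fun j k => by
    rw [← inner_conj_symm, conj_inner_etaProd_gaussMonomialVec hP]
  set cb : ℕ → ℂ := fun k => conj (c k) with hcb
  have hgen : ∀ k, k < m → ⟪etaProd P (gaussMonomialVec k), etaProd P (gaussComb m c)⟫_ℂ = 0 := by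
    intro k hk
    have hmem : etaProd P (gaussMonomialVec k) ∈ ⨆ (j : ℕ) (_ : j < m), semilocalFiltrationOf P j := by
      rw [iSup_semilocalFiltrationOf_lt]
      exact Submodule.subset_span ⟨k, hk, rfl⟩
    exact Submodule.inner_right_of_mem_orthogonal hmem (Submodule.mem_inf.1 hu).2
  have hub : etaProd P (gaussComb m cb) ∈ semilocalLayerOf P m := by
    refine Submodule.mem_inf.2 ⟨etaProd_gaussComb_mem P m cb, ?_⟩
    have hS : Submodule.span ℂ ((fun k => etaProd P (gaussMonomialVec k)) '' Set.Iio m) ≤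
        (ℂ ∙ etaProd P (gaussComb m cb))ᗮ := by
      refine Submodule.span_le.2 ?_
      rintro _ ⟨k, hk, rfl⟩
      rw [SetLike.mem_coe, Submodule.mem_orthogonal_singleton_iff_inner_right]
      have h0 := hgen k hk
      rw [etaProd_gaussComb, inner_sum] at h0
      rw [etaProd_gaussComb, sum_inner]
      simp only [inner_smul_right] at h0
      simp only [inner_smul_left, hcb, Complex.conj_conj]
      rw [← h0]
      exact Finset.sum_congr rfl fun j _ => by rw [hr j k]
    rw [iSup_semilocalFiltrationOf_lt, Submodule.mem_orthogonal]
    intro w hw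
    exact inner_eq_zero_symm.mp (Submodule.mem_orthogonal_singleton_iff_inner_right.mp (hS hw))
  obtain ⟨c₀, -, hline⟩ := exists_semilocalLayerOf_eq_span P m
  have hu' := hu
  rw [hline] at hu' hub
  obtain ⟨b, hb⟩ := Submodule.mem_span_singleton.1 hu'
  obtain ⟨b', hb'⟩ := Submodule.mem_span_singleton.1 hub
  have hb0 : b ≠ 0 := by
    rintro rfl
    exact hu0 (by rw [← hb, zero_smul])
  set lam : ℂ := b' * b⁻¹ with hlam
  have hvec : etaProd P (gaussComb m cb) = lam • etaProd P (gaussComb m c) := by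
    rw [← hb', ← hb, smul_smul, hlam, mul_assoc, inv_mul_cancel₀ hb0, mul_one]
  have hH : ∀ k, conj (c k) = lam * c k := by
    have hG : gaussComb m cb = gaussComb m (fun k => lam * c k) := by
      refine etaProd_injective P ?_
      rw [hvec, gaussComb_smul, map_smul]
    have hG0 : gaussComb m (fun k => cb k - lam * c k) = 0 := by
      rw [← gaussComb_sub, hG, sub_self]
    intro k
    by_cases hk : k ≤ m
    · exact sub_eq_zero.mp (eq_zero_of_gaussComb_eq_zero hG0 k hk)
    · rw [hc k (not_le.mp hk), map_zero, mul_zero]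
  have hD : conj lam * lam = 1 := by
    by_contra hne
    apply hu0
    have hc0 : ∀ k, c k = 0 := by
      intro k
      have h1 := hH k
      have h2 := congrArg conj h1
      rw [Complex.conj_conj, map_mul, h1, ← mul_assoc] at h2
      by_contra hck
      exact hne (mul_right_cancel₀ hck (by rw [← h2, one_mul]))
    have : gaussComb m c = 0 := by
      simp [gaussComb, hc0]
    rw [this, map_zero]
  have hB : ∀ j, conj (scalingGenCoeff c j) = -lam * scalingGenCoeff c j := by
    intro j
    unfold scalingGenCoeff
    split_ifs with hj
    · simp only [map_mul, map_sub, map_neg, Complex.conj_I, map_add, map_div₀, map_one, map_ofNat,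
        map_natCast, Complex.conj_ofReal, map_zero, hH]
      ring
    · simp only [map_mul, map_sub, map_neg, Complex.conj_I, map_add, map_div₀, map_one, map_ofNat,
        map_natCast, Complex.conj_ofReal, hH]
      ring
  set z := ⟪etaProd P (gaussComb (m + 1) (scalingGenCoeff c)), etaProd P (gaussComb m c)⟫_ℂ with hz
  have hA : conj z = z := by
    rw [hz, inner_conj_symm]
    exact (inner_etaProd_theta_symm hP m m c c (hc _ (Nat.lt_succ_self m)) (hc _ (Nat.lt_succ_self m))).symm
  have hC : conj z = -(conj lam * lam) * z := by
    rw [hz, inner_etaProd_gaussComb, map_sum, Finset.mul_sum]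
    refine Finset.sum_congr rfl fun j _ => ?_
    rw [map_sum, Finset.mul_sum]
    refine Finset.sum_congr rfl fun k _ => ?_
    rw [map_mul, map_mul, Complex.conj_conj, conj_inner_etaProd_gaussMonomialVec hP, hH k]
    have hBj := hB j
    have e : scalingGenCoeff c j = -(conj lam) * conj (scalingGenCoeff c j) := by
      have := congrArg conj hBj
      rw [Complex.conj_conj, map_mul, map_neg] at this
      linear_combination this
    linear_combination
      (lam * c k * ⟪etaProd P (gaussMonomialVec j), etaProd P (gaussMonomialVec k)⟫_ℂ) * e
  rw [hD] at hC
  have : z = -z :=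
    calc z = conj z := hA.symm
      _ = -1 * z := hC
      _ = -z := by ring
  linear_combination this / 2

/-- **Theorem 4.1 (iii) for a general finite `S ∋ ∞`** (pulled back): "The matrix of `ϑ_S` in the above orthonormal
basis of `L²(X_S)^{K_S}` is a Jacobi hermitian matrix" (proof: "Follows from (6), the general theory of orthogonal
polynomials") — for a layer-`m` vector `η_SG(m, c)` (coefficients supported in `k ≤ m`), its `ϑ_S`-image
`η_SG(m+1, ϑc)` is orthogonal to every layer `n ∉ {m−1, m+1}` (tridiagonal with zero diagonal, eq. (6), the even
case; hermitian symmetry of the off-diagonals is `inner_etaProd_theta_symm`).  PROVED as in the row file: `n ≥ m+2`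
— `ϑ_SE_m^S ⊆ E_{m+1}^S ⊥` layer `n`; `n ≤ m−2` — symmetry moves `ϑ_S` onto the layer-`n` vector; `n = m` —
`inner_etaProd_theta_self`.  RH-FREE. [cite: ConnesConsaniMoscovici2024, Thm. 4.1 (iii) §4.3 p. 18 (arXiv chunk p0013:L49, proof L52); §2.2 eq. (6) p. 6] -/
theorem inner_etaProd_theta_layer_eq_zero (hP : ∀ p ∈ P, p.Prime) (m n : ℕ) (c : ℕ → ℂ)
    (hc : ∀ k, m < k → c k = 0) (hu : etaProd P (gaussComb m c) ∈ semilocalLayerOf P m)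
    (h1 : n + 1 ≠ m) (h2 : m + 1 ≠ n) (v : Lp ℂ 2 (volume : Measure ℝ)) (hv : v ∈ semilocalLayerOf P n) :
    ⟪etaProd P (gaussComb (m + 1) (scalingGenCoeff c)), v⟫_ℂ = 0 := by
  rcases Nat.lt_or_ge n m with hnm | hmn
  · have hn2 : n + 1 < m := by omega
    obtain ⟨d, hd, rfl⟩ := exists_eq_etaProd_gaussComb (Submodule.mem_inf.1 hv).1
    rw [inner_etaProd_theta_symm hP m n c d (hc _ (Nat.lt_succ_self m)) (hd _ (Nat.lt_succ_self n))]
    have hmem : etaProd P (gaussComb (n + 1) (scalingGenCoeff d)) ∈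
        ⨆ (k : ℕ) (_ : k < m), semilocalFiltrationOf P k :=
      (le_iSup₂ (f := fun k (_ : k < m) => semilocalFiltrationOf P k) (n + 1) hn2)
        (etaProd_gaussComb_mem P (n + 1) _)
    exact Submodule.inner_left_of_mem_orthogonal hmem (Submodule.mem_inf.1 hu).2
  · rcases hmn.eq_or_lt with heq | hlt
    · subst heq
      obtain ⟨c₀, -, hline⟩ := exists_semilocalLayerOf_eq_span P m
      have hu' := hu
      have hv' := hv
      rw [hline] at hu' hv'
      obtain ⟨a, ha⟩ := Submodule.mem_span_singleton.1 hv'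
      obtain ⟨b, hb⟩ := Submodule.mem_span_singleton.1 hu'
      by_cases hb0 : b = 0
      · rw [hb0, zero_smul] at hb
        rw [etaProd_theta_eq_zero P hc hb.symm, inner_zero_left]
      · have hv_eq : v = (a * b⁻¹) • etaProd P (gaussComb m c) := by
          rw [← ha, ← hb, smul_smul, mul_assoc, inv_mul_cancel₀ hb0, mul_one]
        rw [hv_eq, inner_smul_right, inner_etaProd_theta_self hP hc hu, mul_zero]
    · have hm2 : m + 1 < n := by omega
      have hmem : etaProd P (gaussComb (m + 1) (scalingGenCoeff c)) ∈
          ⨆ (k : ℕ) (_ : k < n), semilocalFiltrationOf P k :=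
        (le_iSup₂ (f := fun k (_ : k < n) => semilocalFiltrationOf P k) (m + 1) hm2)
          (etaProd_gaussComb_mem P (m + 1) _)
      exact Submodule.inner_right_of_mem_orthogonal hmem (Submodule.mem_inf.1 hv).2

/-- For `P = {p}` the general statements specialise to the row file's named facts: Thm. 4.1 (ii). [cite: ConnesConsaniMoscovici2024, Thm. 4.1 (ii) §4.3 p. 18 (arXiv chunk p0013:L47)] -/
theorem thm_4_1_ii_of_general (q : ℕ) [Fact q.Prime] : ConnesConsaniMoscovici2024_thm_4_1_ii q := by
  intro n
  obtain ⟨c, hc, h⟩ := exists_semilocalLayerOf_eq_span {q} n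
  refine ⟨c, hc, ?_⟩
  rw [← semilocalLayerOf_singleton, h, etaProd_singleton]

end Gram

end Literature.NumberTheory.ConnesConsani2024
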